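import Mathlib.Data.Real.Basic
import Mathlib.Tactic.Linarith
import Mathlib.Tactic.Ring
import Mathlib.Tactic.Positivity
import HarnessLib

/-!
# THEOREM B½ (STAR½ along a 1|2 bridge), the moment-form chord inequality (real arithmetic)

Support file for the Sahi programme (`--supports stmt-CriticalPhenomena-4575`, prover prim-sahi-p2 gen 19).  No definitions, no named
facts, no sorries; standard axioms; pure real arithmetic.  Memo `FROM-prim-nh-lead-4575-g120-STAR-HALF.md` §5 (i)–(ii) (lead g120), tree
`IncStar.bridgeConcavityHalf_bracket/_core/_chord` (lead, `…IncStarBridgeConcavityHalfCore`, same content in the lead's variables) and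
`prim-sahi-p2/PROOF-E3.md` (29h).

With the moments of Theorem B (`IncStar.bridgeChord_poly`, `…IncStarBridgeEvents`) the STAR½ functional `F = E₃ − ½(m_abc − m_am_bm_c)` satisfies
`F(p) − [(1−p)F(0) + pF(1)] = p(1−p)·[σ(α·RS + d_bd_c·Λ₀) + (3/2)δ_aδ_bδ_c(2−p)]` (by `ring`), with the R-SIDE quantity
`RS = σ′(ξ_b+ξ_c+d_bc) + d_by_c + d_cy_b − (3/2)σ′(m_bd_c + m_cd_b) − 3σ′d_bd_c` and `Λ₀ = 3ασ′ + 2γK − (3/2)τσ − (9/2)ασ′σ ≥ 0`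
(`bridgeHalf_bracket`, from Harris (H2), (H4)).  Hence `(1−p)F(0) + pF(1) ≤ F(p)` whenever `RS ≥ 0` (`bridgeChordHalf_poly`) — the R-side lemma
(`…IncStarRSideCases/DiffBranch`) supplies `RS ≥ 0` on forest far sides under rule (R).
-/

namespace Summit.CriticalPhenomena.PercolationContinuityZ3.Theorems

namespace IncStar

/-- `Λ₀ = 3ασ′ + 2γK − (3/2)τσ − (9/2)ασ′σ ≥ 0` from `τσ ≤ γK`, `γ ≤ γK`, `σ(α+γ) ≤ γ`, `0 ≤ σ′ ≤ 1` (lead g120 §5(ii); `σ, τ ≥ 0` not needed). [this work] -/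
theorem bridgeHalf_bracket (α γ σ τ gK σ' : ℝ) (hα : 0 ≤ α) (hγ : 0 ≤ γ) (hσ'0 : 0 ≤ σ') (hσ'1 : σ' ≤ 1)
    (hK : γ ≤ gK) (H2 : τ * σ ≤ gK) (H4 : σ * (α + γ) ≤ γ) :
    0 ≤ 3 * α * σ' + 2 * gK - 3 / 2 * τ * σ - 9 / 2 * α * σ' * σ := by
  have h1 : 1 / 2 * γ ≤ 2 * gK - 3 / 2 * τ * σ := by nlinarith
  by_cases h3 : 3 / 2 * σ ≤ 1
  · have : 0 ≤ 3 * α * σ' * (1 - 3 / 2 * σ) := mul_nonneg (by positivity) (by linarith)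
    nlinarith
  · push Not at h3
    have hstep : 3 * α * (1 - 3 / 2 * σ) ≤ 3 * α * σ' * (1 - 3 / 2 * σ) := by
      have e : 3 * α * σ' * (1 - 3 / 2 * σ) - 3 * α * (1 - 3 / 2 * σ) = 3 * α * (1 - σ') * (3 / 2 * σ - 1) := by ring
      nlinarith [mul_nonneg (mul_nonneg hα (sub_nonneg.2 hσ'1)) (le_of_lt (sub_pos.2 h3))]
    -- `Ω(3α(1−(3/2)σ) + ½γ) ≥ 3α² − αγ + ½γ² ≥ 0` with `Ω = α+γ`, using `σΩ ≤ γ`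
    have hkey : 0 ≤ 3 * α * (1 - 3 / 2 * σ) + 1 / 2 * γ := by
      by_cases hΩ : α + γ = 0
      · have hα0 : α = 0 := by linarith
        have hγ0 : γ = 0 := by linarith
        rw [hα0, hγ0]; norm_num
      · have hΩpos : 0 < α + γ := lt_of_le_of_ne (by linarith) (Ne.symm hΩ)
        have hprod : 0 ≤ (α + γ) * (3 * α * (1 - 3 / 2 * σ) + 1 / 2 * γ) := by
          have e : (α + γ) * (3 * α * (1 - 3 / 2 * σ) + 1 / 2 * γ)
              = 3 * α * (α + γ) + 1 / 2 * γ * (α + γ) - 9 / 2 * α * (σ * (α + γ)) := by ring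
          rw [e]
          nlinarith [mul_le_mul_of_nonneg_left H4 (by linarith : (0 : ℝ) ≤ 9 / 2 * α), sq_nonneg (α - γ / 6)]
        by_contra hneg
        push Not at hneg
        have : (α + γ) * (3 * α * (1 - 3 / 2 * σ) + 1 / 2 * γ) < 0 := mul_neg_of_pos_of_neg hΩpos hneg
        linarith
    nlinarith

/-- **The chord inequality for `F = E₃ − ½(m_abc − m_am_bm_c)` in moment form** (THEOREM B½ modulo the event identities): with Theorem B's
product-form slopes, Harris (H2), (H4) and the R-side lemma `RS ≥ 0`, `(1−p)F(0) + pF(1) ≤ F(p)`. [this work] -/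
theorem bridgeChordHalf_poly (p τ mb mc mbc m1 α γ σ gK σ' db dc dbc ξb ξc yb yc : ℝ)
    (hp0 : 0 ≤ p) (hp1 : p ≤ 1) (hα : 0 ≤ α) (hγ : 0 ≤ γ) (hσ : 0 ≤ σ) (hσ'0 : 0 ≤ σ') (hσ'1 : σ' ≤ 1)
    (hK : γ ≤ gK) (hdb : 0 ≤ db) (hdc : 0 ≤ dc) (H2 : τ * σ ≤ gK) (H4 : σ * (α + γ) ≤ γ)
    (hRS : 0 ≤ σ' * (ξb + ξc + dbc) + db * yc + dc * yb - 3 / 2 * σ' * (mb * dc + mc * db) - 3 * σ' * db * dc) :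
    (1 - p) * ((2 * (τ * mbc) + τ * mb * mc - (τ * mbc + mb * (τ * mc) + mc * (τ * mb))) - 1 / 2 * (τ * mbc - τ * mb * mc))
      + p * ((2 * m1 + (τ + α * σ') * (mb + σ * db) * (mc + σ * dc)
          - ((τ + α * σ') * (mbc + σ * (ξb + ξc + dbc)) + (mb + σ * db) * (τ * mc + (gK * dc + α * yc))
              + (mc + σ * dc) * (τ * mb + (gK * db + α * yb))))
          - 1 / 2 * (m1 - (τ + α * σ') * (mb + σ * db) * (mc + σ * dc)))
    ≤ (2 * (τ * mbc + p * (m1 - τ * mbc))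
        + (τ + p * (α * σ')) * (mb + p * (σ * db)) * (mc + p * (σ * dc))
        - ((τ + p * (α * σ')) * (mbc + p * (σ * (ξb + ξc + dbc)))
            + (mb + p * (σ * db)) * (τ * mc + p * (gK * dc + α * yc))
            + (mc + p * (σ * dc)) * (τ * mb + p * (gK * db + α * yb))))
        - 1 / 2 * ((τ * mbc + p * (m1 - τ * mbc)) - (τ + p * (α * σ')) * (mb + p * (σ * db)) * (mc + p * (σ * dc))) := by
  have hΛ := bridgeHalf_bracket α γ σ τ gK σ' hα hγ hσ'0 hσ'1 hK H2 H4
  rw [← sub_nonneg]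
  have key : (2 * (τ * mbc + p * (m1 - τ * mbc))
        + (τ + p * (α * σ')) * (mb + p * (σ * db)) * (mc + p * (σ * dc))
        - ((τ + p * (α * σ')) * (mbc + p * (σ * (ξb + ξc + dbc)))
            + (mb + p * (σ * db)) * (τ * mc + p * (gK * dc + α * yc))
            + (mc + p * (σ * dc)) * (τ * mb + p * (gK * db + α * yb))))
        - 1 / 2 * ((τ * mbc + p * (m1 - τ * mbc)) - (τ + p * (α * σ')) * (mb + p * (σ * db)) * (mc + p * (σ * dc)))
      - ((1 - p) * ((2 * (τ * mbc) + τ * mb * mc - (τ * mbc + mb * (τ * mc) + mc * (τ * mb))) - 1 / 2 * (τ * mbc - τ * mb * mc))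
        + p * ((2 * m1 + (τ + α * σ') * (mb + σ * db) * (mc + σ * dc)
          - ((τ + α * σ') * (mbc + σ * (ξb + ξc + dbc)) + (mb + σ * db) * (τ * mc + (gK * dc + α * yc))
              + (mc + σ * dc) * (τ * mb + (gK * db + α * yb))))
          - 1 / 2 * (m1 - (τ + α * σ') * (mb + σ * db) * (mc + σ * dc))))
      = p * (1 - p) * (σ * (α * (σ' * (ξb + ξc + dbc) + db * yc + dc * yb - 3 / 2 * σ' * (mb * dc + mc * db) - 3 * σ' * db * dc)
          + db * dc * (3 * α * σ' + 2 * gK - 3 / 2 * τ * σ - 9 / 2 * α * σ' * σ))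
          + 3 / 2 * ((α * σ') * (db * σ) * (dc * σ)) * (2 - p)) := by
    ring
  rw [key]
  have h1 : 0 ≤ p * (1 - p) := mul_nonneg hp0 (by linarith)
  have h2 : 0 ≤ α * (σ' * (ξb + ξc + dbc) + db * yc + dc * yb - 3 / 2 * σ' * (mb * dc + mc * db) - 3 * σ' * db * dc)
      + db * dc * (3 * α * σ' + 2 * gK - 3 / 2 * τ * σ - 9 / 2 * α * σ' * σ) :=
    add_nonneg (mul_nonneg hα hRS) (mul_nonneg (mul_nonneg hdb hdc) hΛ)
  have h3 : 0 ≤ 3 / 2 * ((α * σ') * (db * σ) * (dc * σ)) * (2 - p) :=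
    mul_nonneg (mul_nonneg (by norm_num) (mul_nonneg (mul_nonneg (mul_nonneg hα hσ'0) (mul_nonneg hdb hσ)) (mul_nonneg hdc hσ))) (by linarith)
  exact mul_nonneg h1 (add_nonneg (mul_nonneg hσ h2) h3)

end IncStar

end Summit.CriticalPhenomena.PercolationContinuityZ3.Theorems
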